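import Summits.KontsevichZagierPeriods.Zeta5Search.LaiSweepShard

/-!
# `κ₃` sweep certificate — shard file 069 of 127 (shards 483–489 of 889)

HONEST FRAMING. Systematic search; no irrationality claim unless certified. This file only checks,
by `decide +kernel`, shards 483–489 of the order-cell sweep of the `κ₃` point `(74, 2180, 444; δ74)`
(engine `LaiSweepEngine`, soundness `LaiSweepJump/Free/Eval/Shard/Kappa3`; a shard is `⟨regime, n,
p, q, p', q', Lo, Up⟩`: `n` cells from `p/q` to `p'/q'` with integer rate sums in `[Lo, Up]`, `K =
128`, `D = 2^40`). It draws NO conclusion: only the capstone `LaiKappa3SweepCert`, which needs all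
127 shard files, does. Kernel cost of this file ≈ 560 cells × 0.3 s.
-/

namespace Summit.KontsevichZagierPeriods.Zeta5Search.Sweep

set_option maxHeartbeats 100000000 in
/-- Shard 483: 80 cells of regime B from `164/335` to `213/434`.
[cite: Lai2024BallRivoal, §4 Lemma 4.3] -/
theorem shard483 :
    Shard.check 128 (2^40)
      ⟨true, 80, 164, 335, 213, 434, 14929858060115, 18049175136613⟩ = true := by
  decide +kernel

set_option maxHeartbeats 100000000 in
/-- Shard 484: 80 cells of regime B from `213/434` to `215/437`.
[cite: Lai2024BallRivoal, §4 Lemma 4.3] -/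
theorem shard484 :
    Shard.check 128 (2^40)
      ⟨true, 80, 213, 434, 215, 437, 14595571412269, 17660995434689⟩ = true := by
  decide +kernel

set_option maxHeartbeats 100000000 in
/-- Shard 485: 80 cells of regime B from `215/437` to `184/373`.
[cite: Lai2024BallRivoal, §4 Lemma 4.3] -/
theorem shard485 :
    Shard.check 128 (2^40)
      ⟨true, 80, 215, 437, 184, 373, 15765962673361, 19095008515005⟩ = true := by
  decide +kernel

set_option maxHeartbeats 100000000 in
/-- Shard 486: 80 cells of regime B from `184/373` to `179/362`.
[cite: Lai2024BallRivoal, §4 Lemma 4.3] -/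
theorem shard486 :
    Shard.check 128 (2^40)
      ⟨true, 80, 184, 373, 179, 362, 14206946844009, 17222645738326⟩ = true := by
  decide +kernel

set_option maxHeartbeats 100000000 in
/-- Shard 487: 80 cells of regime B from `179/362` to `176/355`.
[cite: Lai2024BallRivoal, §4 Lemma 4.3] -/
theorem shard487 :
    Shard.check 128 (2^40)
      ⟨true, 80, 179, 362, 176, 355, 15552817111075, 18871622437759⟩ = true := by
  decide +kernel

set_option maxHeartbeats 100000000 in
/-- Shard 488: 80 cells of regime B from `176/355` to `163/328`.
[cite: Lai2024BallRivoal, §4 Lemma 4.3] -/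
theorem shard488 :
    Shard.check 128 (2^40)
      ⟨true, 80, 176, 355, 163, 328, 14116614074039, 17144693443244⟩ = true := by
  decide +kernel

set_option maxHeartbeats 100000000 in
/-- Shard 489: 80 cells of regime B from `163/328` to `128/257`.
[cite: Lai2024BallRivoal, §4 Lemma 4.3] -/
theorem shard489 :
    Shard.check 128 (2^40)
      ⟨true, 80, 163, 328, 128, 257, 13185494566865, 16027425755340⟩ = true := by
  decide +kernel

/-- The checked shards of this file, in order. [folklore] -/
def shards069 : List (CheckedShard 128 (2^40)) :=
  [⟨_, shard483⟩, ⟨_, shard484⟩, ⟨_, shard485⟩, ⟨_, shard486⟩, ⟨_, shard487⟩,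
    ⟨_, shard488⟩, ⟨_, shard489⟩]

end Summit.KontsevichZagierPeriods.Zeta5Search.Sweep
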